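import Literature.AlgebraicGeometry.Pohlmann1968.DegenerateCMTypesRibetLenstraSerre
import HarnessLib

/-!
# Cyclotomic fields of pairwise coprime levels have INDEPENDENT Galois actions on their complex embeddings
# (`Gal(ℚ(ζ_{mn})/ℚ) ≅ Gal(ℚ(ζ_m)/ℚ) × Gal(ℚ(ζ_n)/ℚ)` for `(m, n) = 1`, through `Aut(ℂ)` and the Chinese remainder theorem)

Companion of `Pohlmann1968/DegenerateCMTypeCyclotomic21` (the cyclotomic character `Cyclotomic.autExp n τ ∈ ℤ/n` of an
automorphism `τ` of `ℂ` on `ζ_n = e^{2πi/n}`, `exists_autExp_eq`) and `Pohlmann1968/DegenerateCMTypesRibetLenstraSerre`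
(the exponent `Cyclotomic.expOf N L σ` of a complex embedding of an `N`-th cyclotomic field `L`, `expOf_comp`:
`e(τ ∘ σ) = u_N(τ) · e(σ)`, `expOf_injective`).  The source (held, read through the tree's citations of the same theorem):

* L. C. Washington, *Introduction to Cyclotomic Fields* [Washington1997], **Thm. 2.5**: "`Gal(ℚ(ζ_n)/ℚ) ≅ (ℤ/nℤ)^×`
  … `ζ_n ↦ ζ_n^a`", and **Prop. 2.4**: "if `(m, n) = 1` then `ℚ(ζ_m) ∩ ℚ(ζ_n) = ℚ` and `ℚ(ζ_{mn}) = ℚ(ζ_m)ℚ(ζ_n)`", whence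
  `Gal(ℚ(ζ_{mn})/ℚ) ≅ (ℤ/mn)^× ≅ (ℤ/m)^× × (ℤ/n)^× ≅ Gal(ℚ(ζ_m)/ℚ) × Gal(ℚ(ζ_n)/ℚ)` (Chinese remainder theorem).

## What is proved (everything; no definition, no named fact, no `sorry`)

* `Cyclotomic.rootζ_pow_div`, **`Cyclotomic.castHom_autExp`** — compatibility of the cyclotomic characters between
  levels: for `N ∣ M`, `ζ_M^{M/N} = ζ_N` and `u_N(τ) = u_M(τ) mod N`;
* **`Cyclotomic.exists_autExp_eq_forall`** — for pairwise coprime levels `(N_i)_{i∈I}` and prescribed units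
  `u_i ∈ (ℤ/N_i)^×` there is `τ ∈ Aut(ℂ)` with `u_{N_i}(τ) = u_i` for all `i` (CRT in `ℤ/∏N_i`, Mathlib's `ZMod.prodEquivPi`,
  then `exists_autExp_eq`);
* **`Cyclotomic.exists_ringEquiv_comp_eq_of_coprime`** — SLOTWISE INDEPENDENCE of `Aut(ℂ)` on the embeddings of
  cyclotomic fields `K_i ⊇ ℚ(ζ_{N_i})`, `K_i` an `N_i`-th cyclotomic extension of `ℚ`, of pairwise coprime levels: for every
  `i` and `g ∈ Aut(ℂ)` some `τ ∈ Aut(ℂ)` satisfies `τ ∘ s = g ∘ s` for all `s : K_i → ℂ` and `τ ∘ t = t` for all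
  `t : K_j → ℂ`, `j ≠ i` — literally the hypothesis `SlotwiseIndependent (ℂ ≃+* ℂ) (fun i => K_i →+* ℂ)` of
  `NumberTheory/ComplexMultiplication/CMTypeRankFamilies` (spelled out here, so that this file does not depend on it),
  under which the rank of a family of CM types of the `K_i` is additive and products of nondegenerate CM abelian varieties
  with CM by the `K_i` are stably nondegenerate (`Summits/HodgeConjecture/CorCM/IndependentCMFieldsHodge`).

## References

* [Washington1997] L. C. Washington, *Introduction to Cyclotomic Fields*, 2nd ed., GTM 83 (1997), Prop. 2.4, Thm. 2.5.
-/

noncomputable section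

open NumberField Polynomial
open scoped Function -- `on`

namespace Literature.AlgebraicGeometry.Pohlmann1968

namespace Cyclotomic

open Literature.NumberTheory.ComplexMultiplication

/-! ### Compatibility of the cyclotomic characters between levels `N ∣ M` -/

section Levels

variable (N M : ℕ) [NeZero N] [NeZero M]

/-- `ζ_n = e^{2πi/n}` is a primitive `n`-th root of unity (Mathlib `Complex.isPrimitiveRoot_exp`). [cite: Washington1997, Thm. 2.5] -/
theorem isPrimitiveRoot_rootζ' : IsPrimitiveRoot (rootζ N) N := by
  simpa [rootζ] using Complex.isPrimitiveRoot_exp N (NeZero.ne N)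

/-- **`ζ_M^{M/N} = ζ_N` for `N ∣ M`** (`e^{2πi (M/N)/M} = e^{2πi/N}`): the `N`-th roots of unity inside the `M`-th.
[cite: Washington1997, Prop. 2.4] -/
theorem rootζ_pow_div (h : N ∣ M) : rootζ M ^ (M / N) = rootζ N := by
  obtain ⟨q, hq⟩ := h
  have hN : (N : ℂ) ≠ 0 := Nat.cast_ne_zero.2 (NeZero.ne N)
  have hq0 : q ≠ 0 := by
    rintro rfl
    exact NeZero.ne M (by rw [hq, mul_zero])
  have hMq : M / N = q := by rw [hq, Nat.mul_div_cancel_left q (Nat.pos_of_ne_zero (NeZero.ne N))]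
  rw [hMq, rootζ, rootζ, ← Complex.exp_nat_mul, hq, Nat.cast_mul]
  congr 1
  have hqC : (q : ℂ) ≠ 0 := Nat.cast_ne_zero.2 hq0
  field_simp

/-- **`u_N(τ) = u_M(τ) mod N` for `N ∣ M`**: the cyclotomic characters of `τ ∈ Aut(ℂ)` are compatible under
`(ℤ/M)^× → (ℤ/N)^×` (`τ ζ_N = τ (ζ_M^{M/N}) = ζ_M^{u_M(τ) M/N} = ζ_N^{u_M(τ)}`). [cite: Washington1997, Thm. 2.5] -/
theorem castHom_autExp (h : N ∣ M) (τ : ℂ ≃+* ℂ) : ZMod.castHom h (ZMod N) (autExp M τ) = autExp N τ := by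
  have hζN := isPrimitiveRoot_rootζ' N
  -- `τ ζ_N = ζ_N ^ u_M(τ)`
  have h1 : τ (rootζ N) = rootζ N ^ (autExp M τ).val := by
    rw [← rootζ_pow_div N M h, map_pow, autExp_spec M τ, ← pow_mul, mul_comm, pow_mul]
  rw [autExp_spec N τ] at h1
  -- compare exponents modulo `N`
  have h2 : rootζ N ^ ((autExp N τ).val % N) = rootζ N ^ ((autExp M τ).val % N) := by
    rw [← pow_eq_pow_mod _ hζN.pow_eq_one, ← pow_eq_pow_mod _ hζN.pow_eq_one, h1]
  have h3 : (autExp N τ).val % N = (autExp M τ).val % N :=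
    hζN.pow_inj (Nat.mod_lt _ (Nat.pos_of_ne_zero (NeZero.ne N))) (Nat.mod_lt _ (Nat.pos_of_ne_zero (NeZero.ne N))) h2
  rw [ZMod.castHom_apply, ZMod.cast_eq_val, ← ZMod.natCast_mod, ← h3, ZMod.natCast_mod, ZMod.natCast_zmod_val]

end Levels

/-! ### Prescribing the characters at pairwise coprime levels (Chinese remainder theorem) -/

section CRT

/-- **Automorphisms of `ℂ` with prescribed cyclotomic characters at pairwise coprime levels**: for units
`u_i ∈ (ℤ/N_i)^×`, some `τ ∈ Aut(ℂ)` has `u_{N_i}(τ) = u_i` for every `i` — `Gal(ℚ(ζ_{∏N_i})/ℚ) ≅ (ℤ/∏N_i)^× ≅ ∏_i (ℤ/N_i)^×`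
(CRT, Mathlib's `ZMod.prodEquivPi`) and every unit of `ℤ/∏N_i` is the character of an automorphism of `ℂ`
(`exists_autExp_eq`). [cite: Washington1997, Prop. 2.4 and Thm. 2.5] -/
theorem exists_autExp_eq_forall {I : Type} [Fintype I] (N : I → ℕ) [∀ i, NeZero (N i)]
    (hcop : Pairwise (Nat.Coprime on N)) (u : ∀ i, ZMod (N i)) (hu : ∀ i, (u i).val.Coprime (N i)) :
    ∃ τ : ℂ ≃+* ℂ, ∀ i, autExp (N i) τ = u i := by
  haveI : NeZero (∏ i, N i) := ⟨Finset.prod_ne_zero_iff.2 fun i _ => NeZero.ne (N i)⟩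
  set c : ZMod (∏ i, N i) := (ZMod.prodEquivPi N hcop).symm u with hc_def
  have hcu : IsUnit c := by
    have hu' : IsUnit u := Pi.isUnit_iff.2 fun i => by
      have := (ZMod.isUnit_iff_coprime (u i).val (N i)).2 (hu i)
      rwa [ZMod.natCast_zmod_val] at this
    exact hu'.map (ZMod.prodEquivPi N hcop).symm
  have hc : c.val.Coprime (∏ i, N i) := by
    rw [← ZMod.isUnit_iff_coprime, ZMod.natCast_zmod_val]
    exact hcu
  obtain ⟨τ, hτ⟩ := exists_autExp_eq (∏ i, N i) c hc
  refine ⟨τ, fun i => ?_⟩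
  rw [← castHom_autExp (N i) (∏ i, N i) (Finset.dvd_prod_of_mem N (Finset.mem_univ i)) τ, hτ,
    ← ZMod.prodEquivPi_apply N hcop c i, hc_def, RingEquiv.apply_symm_apply]

end CRT

/-! ### Slotwise independence of `Aut(ℂ)` on the embeddings of cyclotomic fields of coprime levels -/

section Independence

variable {I : Type} [Fintype I] [DecidableEq I] (N : I → ℕ) [∀ i, NeZero (N i)]
  (K : I → Type) [∀ i, Field (K i)] [∀ i, NumberField (K i)] [∀ i, IsCyclotomicExtension {N i} ℚ (K i)]

/-- `τ ∈ Aut(ℂ)` acts on an embedding `s` of an `N`-th cyclotomic field as any `g` with the same level-`N` character: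
`u_N(τ) = u_N(g) ⟹ τ ∘ s = g ∘ s` (`e(τ ∘ s) = u_N(τ) e(s)` and `e` is injective). [cite: Washington1997, Thm. 2.5] -/
theorem comp_eq_comp_of_autExp_eq {N : ℕ} [NeZero N] {L : Type} [Field L] [NumberField L]
    [IsCyclotomicExtension {N} ℚ L] {τ g : ℂ ≃+* ℂ} (h : autExp N τ = autExp N g) (s : L →+* ℂ) :
    (τ : ℂ →+* ℂ).comp s = (g : ℂ →+* ℂ).comp s :=
  expOf_injective N L (by rw [expOf_comp, expOf_comp, h])

/-- **Cyclotomic fields of pairwise coprime levels have slotwise independent Galois actions on their embeddings**: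
for `K_i` an `N_i`-th cyclotomic extension of `ℚ` with the `N_i` pairwise coprime, every `i` and every `g ∈ Aut(ℂ)`,
some `τ ∈ Aut(ℂ)` acts as `g` on `Hom(K_i, ℂ)` and trivially on `Hom(K_j, ℂ)` for all `j ≠ i`
(`Gal(ℚ(ζ_{mn})/ℚ) ≅ Gal(ℚ(ζ_m)/ℚ) × Gal(ℚ(ζ_n)/ℚ)`, `(m,n) = 1`).  This is the hypothesis
`SlotwiseIndependent (ℂ ≃+* ℂ) (fun i => K_i →+* ℂ)` of `NumberTheory/ComplexMultiplication/CMTypeRankFamilies`,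
spelled out. [cite: Washington1997, Prop. 2.4 and Thm. 2.5] -/
theorem exists_ringEquiv_comp_eq_of_coprime (hcop : Pairwise (Nat.Coprime on N)) (i : I) (g : ℂ ≃+* ℂ) :
    ∃ τ : ℂ ≃+* ℂ, (∀ s : K i →+* ℂ, (τ : ℂ →+* ℂ).comp s = (g : ℂ →+* ℂ).comp s) ∧
      ∀ j, j ≠ i → ∀ t : K j →+* ℂ, (τ : ℂ →+* ℂ).comp t = t := by
  -- prescribe the character of `g` at the level `N_i` and the trivial character elsewhere
  obtain ⟨τ, hτ⟩ := exists_autExp_eq_forall N hcop (fun j => autExp (N j) (if j = i then g else 1))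
    fun j => coprime_autExp (N j) _
  refine ⟨τ, fun s => ?_, fun j hj t => ?_⟩
  · have h := hτ i
    rw [if_pos rfl] at h
    exact comp_eq_comp_of_autExp_eq h s
  · have h := hτ j
    rw [if_neg hj] at h
    rw [comp_eq_comp_of_autExp_eq h t]
    exact RingHom.ext fun _ => rfl

/-- The same in the `Aut(ℂ)`-action spelling of the tree (`τ • s = τ ∘ s`, `EmbeddingAction`): for every slot `i` and
`g ∈ Aut(ℂ)` some `τ` satisfies `τ • s = g • s` on `Hom(K_i, ℂ)` and `τ • t = t` on `Hom(K_j, ℂ)`, `j ≠ i`.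
[cite: Washington1997, Prop. 2.4 and Thm. 2.5] -/
theorem exists_smul_eq_of_coprime (hcop : Pairwise (Nat.Coprime on N)) (i : I) (g : ℂ ≃+* ℂ) :
    ∃ τ : ℂ ≃+* ℂ, (∀ s : K i →+* ℂ, τ • s = g • s) ∧ ∀ j, j ≠ i → ∀ t : K j →+* ℂ, τ • t = t :=
  exists_ringEquiv_comp_eq_of_coprime N K hcop i g

end Independence

end Cyclotomic

end Literature.AlgebraicGeometry.Pohlmann1968

end
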